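import Summits.AnomalousDissipation.AnomalousDissipation.Theorems.SolenoidalFractalHomogenisationLagrangianStepCellLawVQSResp
import Mathlib.Analysis.SpecialFunctions.Sqrt
import HarnessLib

/-!
# K1L `LagrangianRenormalisationStep(Design)` (K1L_D, stmt-AnomalousDissipation-27980), stub `stub_cellLawV0_IS`, IS-half obligation
# `stub_W_evenSlackB`, analytic stub S2 «odd/even comparison» — PART 1/3: the abstract FORCED ENERGY BOUND and the symmetric/skew algebra
# (helper; `--supports … --as helper`; word-independent)

Summits-side helper file of route `SolenoidalFractalHomogenisation` (prover seat `ad-sawtooth-k1loc-p1` g12; planner ad-ideate-p5 g12's even certificate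
`Lines/onelevel_W_evenSlack_cert.lean`, v2 cut 2026-08-29T00:02:52Z, stub S2 `stub_oddEven`).  This part proves, for `X' = −B_s X + F`, `X(0) = 0`,
`b|w|² ≤ wᵀB_s w` and a majorant `G` with `G(0) = 0`, `G'(t) ≥ e^{bt}|F(t)|` (`t ≥ 0`): **`|X(t)| ≤ e^{−bt} G(t)`** (`forced_energy_bound`; energy identity
for `e^{2bt}|X|²`, the regularised norm `√(e^{2bt}|X|² + ε²)` is differentiable with derivative `≤ G'`, `antitoneOn_of_deriv_nonpos`, `ε → 0`) — the
ODE comparison lemma the three orbit estimates of part 2 instantiate; plus coordinate Cauchy–Schwarz / Minkowski and the algebra of `B_s = ½(B + Bᵀ)`,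
`B − B_s = ½(B − Bᵀ)`, and the skew bound in vector form `(uᵀBw − wᵀBu)² ≤ 4ω²|u|²|w|² ⟹ |(B − Bᵀ)y| ≤ 2|ω||y|` (`sum_sq_skew_mulVec_le`).
Everything PROVED, no definition, no named fact, no sorry.  Infrastructure for rung leaf F-D1.A0; NOT a proof of the stub, of the crux, of Onsager's
conjecture or of anomalous dissipation.
-/

set_option linter.dupNamespace false

noncomputable section

namespace Summit.AnomalousDissipation.AnomalousDissipation.Theorems.SolenoidalFractalHomogenisation.LagrangianStep

open Literature.Analysis Literature.Analysis.FluidPDE Literature.Analysis.FunctionSpaces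
open Literature.Analysis.ODE.PeriodicAveraging
open MeasureTheory Set Real Matrix

/-! ## §1 The abstract forced energy bound -/

section Forced

variable {m : ℕ}

/-- Cauchy–Schwarz in coordinates: `Σ xᵢyᵢ ≤ √(Σxᵢ²)·√(Σyᵢ²)`. [folklore] -/
theorem sum_mul_le_sqrt_mul_sqrt (x y : Fin m → ℝ) :
    ∑ i, x i * y i ≤ Real.sqrt (∑ i, x i ^ 2) * Real.sqrt (∑ i, y i ^ 2) := by
  rw [← Real.sqrt_mul (Finset.sum_nonneg fun i _ => sq_nonneg (x i))]
  refine Real.le_sqrt_of_sq_le ?_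
  exact Finset.sum_mul_sq_le_sq_mul_sq Finset.univ x y

/-- **Forced energy bound.**  `X' = −B_s X + F` with `b|w|² ≤ wᵀB_s w`, `X(0) = 0`, and a majorant `G` (`G(0) = 0`, `G' ≥ e^{bt}|F(t)|` for
`t ≥ 0`): then `|X(t)| ≤ e^{−bt} G(t)` for `t ≥ 0`.  (Energy identity for `e^{2bt}|X|²`, regularised norm `√(· + ε²)`, monotonicity.) [folklore] -/
theorem forced_energy_bound (Bs : Matrix (Fin m) (Fin m) ℝ) {b : ℝ}
    (hBs : ∀ w : Fin m → ℝ, b * ∑ i, w i ^ 2 ≤ ∑ i, ∑ j, w i * Bs i j * w j)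
    (X F : ℝ → Fin m → ℝ) (hX : ∀ t, HasDerivAt X (-(Bs.mulVec (X t)) + F t) t) (hX0 : X 0 = 0)
    (G G' : ℝ → ℝ) (hG : ∀ t, HasDerivAt G (G' t) t) (hG0 : G 0 = 0)
    (hF : ∀ t, 0 ≤ t → Real.exp (b * t) * Real.sqrt (∑ i, F t i ^ 2) ≤ G' t) {t : ℝ} (ht : 0 ≤ t) :
    Real.sqrt (∑ i, X t i ^ 2) ≤ Real.exp (-(b * t)) * G t := by
  -- the energy `E = |X|²` and `N = e^{2bt} E`
  set E : ℝ → ℝ := fun s => ∑ i, X s i ^ 2 with hE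
  have hEd : ∀ s, HasDerivAt E (∑ i, 2 * X s i * (-(Bs.mulVec (X s)) + F s) i) s := by
    intro s
    have h := hX s
    rw [hasDerivAt_pi] at h
    have h2 := HasDerivAt.fun_sum (u := Finset.univ) fun i _ => (h i).fun_pow 2
    refine h2.congr_deriv (Finset.sum_congr rfl fun i _ => ?_)
    simp only [Nat.cast_ofNat, Nat.add_one_sub_one, pow_one]
  set N : ℝ → ℝ := fun s => Real.exp (2 * b * s) * E s with hN
  have hNd : ∀ s, HasDerivAt N (Real.exp (2 * b * s) * (2 * b) * E s
      + Real.exp (2 * b * s) * ∑ i, 2 * X s i * (-(Bs.mulVec (X s)) + F s) i) s := by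
    intro s
    have h1 : HasDerivAt (fun s => Real.exp (2 * b * s)) (Real.exp (2 * b * s) * (2 * b)) s := by
      have := ((hasDerivAt_id s).const_mul (2 * b)).exp
      simpa using this
    exact h1.mul (hEd s)
  have hE0 : ∀ s, 0 ≤ E s := fun s => Finset.sum_nonneg fun i _ => sq_nonneg _
  have hN0 : ∀ s, 0 ≤ N s := fun s => mul_nonneg (Real.exp_pos _).le (hE0 s)
  -- the key differential inequality `N' ≤ 2 √N G'` for `s ≥ 0`
  have hkey : ∀ s, 0 ≤ s → Real.exp (2 * b * s) * (2 * b) * E s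
      + Real.exp (2 * b * s) * ∑ i, 2 * X s i * (-(Bs.mulVec (X s)) + F s) i ≤ 2 * Real.sqrt (N s) * G' s := by
    intro s hs
    have hq : ∑ i, 2 * X s i * (-(Bs.mulVec (X s)) + F s) i
        = -2 * ∑ i, ∑ j, X s i * Bs i j * X s j + 2 * ∑ i, X s i * F s i := by
      have hi : ∀ i, 2 * X s i * (-(Bs.mulVec (X s)) + F s) i
          = 2 * (X s i * F s i) - 2 * (X s i * Bs.mulVec (X s) i) := fun i => by
        simp only [Pi.add_apply, Pi.neg_apply]; ring
      simp only [hi, Finset.sum_sub_distrib, ← Finset.mul_sum, sum_mul_mulVec_eq_sum_sum]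
      ring
    rw [hq]
    have h1 := hBs (X s)
    have h2 : ∑ i, X s i * F s i ≤ Real.sqrt (E s) * Real.sqrt (∑ i, F s i ^ 2) := sum_mul_le_sqrt_mul_sqrt _ _
    have h3 : Real.sqrt (N s) = Real.exp (b * s) * Real.sqrt (E s) := by
      have he : Real.exp (2 * b * s) = Real.exp (b * s) ^ 2 := by
        rw [← Real.exp_nat_mul]; ring_nf
      show Real.sqrt (Real.exp (2 * b * s) * E s) = _
      rw [he, Real.sqrt_mul (sq_nonneg _), Real.sqrt_sq (Real.exp_pos _).le]
    have h4 := hF s hs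
    have hexp : Real.exp (2 * b * s) = Real.exp (b * s) * Real.exp (b * s) := by
      rw [← Real.exp_add]; ring_nf
    rw [h3, hexp]
    have hpos : 0 ≤ Real.exp (b * s) * Real.sqrt (E s) := mul_nonneg (Real.exp_pos _).le (Real.sqrt_nonneg _)
    have hepos : 0 < Real.exp (b * s) := Real.exp_pos _
    nlinarith [mul_le_mul_of_nonneg_left h4 hpos, mul_le_mul_of_nonneg_left h2 (mul_pos hepos hepos).le,
      mul_le_mul_of_nonneg_left h1 (mul_pos hepos hepos).le]
  -- `G' ≥ 0` on `s ≥ 0`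
  have hG'0 : ∀ s, 0 ≤ s → 0 ≤ G' s := fun s hs =>
    le_trans (mul_nonneg (Real.exp_pos _).le (Real.sqrt_nonneg _)) (hF s hs)
  -- the regularised norm and its monotonicity
  have hmain : ∀ ε : ℝ, 0 < ε → Real.sqrt (N t) ≤ G t + ε := by
    intro ε hε
    set h : ℝ → ℝ := fun s => Real.sqrt (N s + ε ^ 2) - G s with hh
    have hpos : ∀ s, 0 < N s + ε ^ 2 := fun s => by positivity
    have hhd : ∀ s, HasDerivAt h ((Real.exp (2 * b * s) * (2 * b) * E s
        + Real.exp (2 * b * s) * ∑ i, 2 * X s i * (-(Bs.mulVec (X s)) + F s) i) / (2 * Real.sqrt (N s + ε ^ 2)) - G' s) s := by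
      intro s
      have h1 := ((hNd s).add_const (ε ^ 2)).sqrt (hpos s).ne'
      exact h1.sub (hG s)
    have hanti : AntitoneOn h (Ici 0) := by
      refine antitoneOn_of_deriv_nonpos (convex_Ici 0) ?_ ?_ ?_
      · exact fun s _ => (hhd s).continuousAt.continuousWithinAt
      · exact fun s _ => (hhd s).differentiableAt.differentiableWithinAt
      · intro s hs
        rw [interior_Ici] at hs
        rw [(hhd s).deriv, sub_nonpos]
        have hs' : 0 ≤ s := le_of_lt hs
        have hk := hkey s hs'
        have hsq : Real.sqrt (N s) ≤ Real.sqrt (N s + ε ^ 2) := Real.sqrt_le_sqrt (by nlinarith)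
        have hroot : 0 < Real.sqrt (N s + ε ^ 2) := Real.sqrt_pos.2 (hpos s)
        rw [div_le_iff₀ (by positivity)]
        nlinarith [hG'0 s hs', mul_le_mul_of_nonneg_right hsq (hG'0 s hs')]
    have hh0 : h 0 = ε := by
      rw [hh]
      simp only
      rw [hN]
      simp only [mul_zero, Real.exp_zero, one_mul]
      rw [hE]
      simp only [hX0, Pi.zero_apply, ne_eq, OfNat.ofNat_ne_zero, not_false_eq_true, zero_pow, Finset.sum_const_zero,
        zero_add, hG0, sub_zero]
      exact Real.sqrt_sq hε.le
    have hle : h t ≤ h 0 := hanti (mem_Ici.2 le_rfl) (mem_Ici.2 ht) ht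
    rw [hh0] at hle
    have hsq : Real.sqrt (N t) ≤ Real.sqrt (N t + ε ^ 2) := Real.sqrt_le_sqrt (by nlinarith)
    have : Real.sqrt (N t + ε ^ 2) - G t ≤ ε := hle
    linarith
  have hNt : Real.sqrt (N t) ≤ G t := le_of_forall_pos_le_add fun ε hε => hmain ε hε
  have h3 : Real.sqrt (N t) = Real.exp (b * t) * Real.sqrt (E t) := by
    have he : Real.exp (2 * b * t) = Real.exp (b * t) ^ 2 := by
      rw [← Real.exp_nat_mul]; ring_nf
    show Real.sqrt (Real.exp (2 * b * t) * E t) = _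
    rw [he, Real.sqrt_mul (sq_nonneg _), Real.sqrt_sq (Real.exp_pos _).le]
  rw [h3] at hNt
  have hexp : Real.exp (-(b * t)) * Real.exp (b * t) = 1 := by rw [← Real.exp_add]; simp
  calc Real.sqrt (∑ i, X t i ^ 2) = Real.exp (-(b * t)) * (Real.exp (b * t) * Real.sqrt (E t)) := by
        rw [← mul_assoc, hexp, one_mul]
    _ ≤ Real.exp (-(b * t)) * G t := mul_le_mul_of_nonneg_left hNt (Real.exp_pos _).le

/-- Minkowski in coordinates: `√(Σ(xᵢ+yᵢ)²) ≤ √(Σxᵢ²) + √(Σyᵢ²)`. [folklore] -/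
theorem sqrt_sum_sq_add_le (x y : Fin m → ℝ) :
    Real.sqrt (∑ i, (x i + y i) ^ 2) ≤ Real.sqrt (∑ i, x i ^ 2) + Real.sqrt (∑ i, y i ^ 2) := by
  have hX := Real.sqrt_nonneg (∑ i, x i ^ 2)
  have hY := Real.sqrt_nonneg (∑ i, y i ^ 2)
  refine Real.sqrt_le_iff.2 ⟨add_nonneg hX hY, ?_⟩
  have hcs := sum_mul_le_sqrt_mul_sqrt x y
  have e : ∑ i, (x i + y i) ^ 2 = ∑ i, x i ^ 2 + 2 * ∑ i, x i * y i + ∑ i, y i ^ 2 := by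
    simp only [add_sq, Finset.sum_add_distrib, Finset.mul_sum]
    refine congrArg₂ _ (congrArg₂ _ rfl (Finset.sum_congr rfl fun i _ => by ring)) rfl
  rw [e, add_sq, Real.sq_sqrt (Finset.sum_nonneg fun i _ => sq_nonneg _),
    Real.sq_sqrt (Finset.sum_nonneg fun i _ => sq_nonneg _)]
  nlinarith

end Forced

/-! ## §2 Symmetric/skew algebra of a real block -/

section Algebra

variable {m : ℕ}

/-- The quadratic form of `Bᵀ` is that of `B`. [folklore] -/
theorem quad_transpose (B : Matrix (Fin m) (Fin m) ℝ) (w : Fin m → ℝ) :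
    ∑ i, ∑ j, w i * Bᵀ i j * w j = ∑ i, ∑ j, w i * B i j * w j := by
  rw [Finset.sum_comm]
  exact Finset.sum_congr rfl fun i _ => Finset.sum_congr rfl fun j _ => by rw [Matrix.transpose_apply]; ring

/-- The quadratic form of the symmetric part `½(B + Bᵀ)` is that of `B`. [folklore] -/
theorem quad_symmPart (B : Matrix (Fin m) (Fin m) ℝ) (w : Fin m → ℝ) :
    ∑ i, ∑ j, w i * ((1 / 2 : ℝ) • (B + Bᵀ)) i j * w j = ∑ i, ∑ j, w i * B i j * w j := by
  have h : ∑ i, ∑ j, w i * ((1 / 2 : ℝ) • (B + Bᵀ)) i j * w j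
      = (1 / 2) * (∑ i, ∑ j, w i * B i j * w j + ∑ i, ∑ j, w i * Bᵀ i j * w j) := by
    simp only [Matrix.smul_apply, Matrix.add_apply, smul_eq_mul, mul_add, add_mul, Finset.sum_add_distrib, Finset.mul_sum]
    exact congrArg₂ _ (Finset.sum_congr rfl fun i _ => Finset.sum_congr rfl fun j _ => by ring)
      (Finset.sum_congr rfl fun i _ => Finset.sum_congr rfl fun j _ => by ring)
  rw [h, quad_transpose]; ring

/-- The symmetric part is symmetric. [folklore] -/
theorem isSymm_symmPart (B : Matrix (Fin m) (Fin m) ℝ) : ((1 / 2 : ℝ) • (B + Bᵀ)).IsSymm :=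
  (Matrix.isSymm_add_transpose_self B).smul _

/-- `B − B_s = ½(B − Bᵀ)` and `Bᵀ − B_s = −½(B − Bᵀ)`. [folklore] -/
theorem sub_symmPart (B : Matrix (Fin m) (Fin m) ℝ) :
    B - (1 / 2 : ℝ) • (B + Bᵀ) = (1 / 2 : ℝ) • (B - Bᵀ) ∧ Bᵀ - (1 / 2 : ℝ) • (B + Bᵀ) = -((1 / 2 : ℝ) • (B - Bᵀ)) := by
  constructor
  · ext i j; simp only [Matrix.sub_apply, Matrix.smul_apply, Matrix.add_apply, smul_eq_mul]; ring
  · ext i j; simp only [Matrix.sub_apply, Matrix.smul_apply, Matrix.add_apply, Matrix.neg_apply, smul_eq_mul]; ring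

/-- **The skew bound in vector form**: `(uᵀBw − wᵀBu)² ≤ 4ω²|u|²|w|²` for all `u, w` gives `|(B − Bᵀ)y| ≤ 2|ω|·|y|`, i.e.
`Σᵢ ((B − Bᵀ)y)ᵢ² ≤ 4ω²·Σ yᵢ²`. [folklore] -/
theorem sum_sq_skew_mulVec_le (B : Matrix (Fin m) (Fin m) ℝ) {ω : ℝ}
    (hω : ∀ u w : Fin m → ℝ, (∑ i, ∑ j, u i * B i j * w j - ∑ i, ∑ j, w i * B i j * u j) ^ 2
      ≤ 4 * ω ^ 2 * (∑ i, u i ^ 2) * (∑ i, w i ^ 2)) (y : Fin m → ℝ) :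
    ∑ i, ((B - Bᵀ).mulVec y i) ^ 2 ≤ 4 * ω ^ 2 * ∑ i, y i ^ 2 := by
  set u := (B - Bᵀ).mulVec y with hu
  have hD : ∑ i, u i ^ 2 = ∑ i, ∑ j, u i * B i j * y j - ∑ i, ∑ j, y i * B i j * u j := by
    have h1 : ∑ i, u i ^ 2 = ∑ i, u i * (B - Bᵀ).mulVec y i := Finset.sum_congr rfl fun i _ => by rw [hu, sq]
    rw [h1, sum_mul_mulVec_eq_sum_sum]
    simp only [Matrix.sub_apply, Matrix.transpose_apply, mul_sub, sub_mul, Finset.sum_sub_distrib]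
    congr 1
    rw [Finset.sum_comm]
    exact Finset.sum_congr rfl fun i _ => Finset.sum_congr rfl fun j _ => by ring
  have h := hω u y
  rw [← hD] at h
  have hU : 0 ≤ ∑ i, u i ^ 2 := Finset.sum_nonneg fun i _ => sq_nonneg _
  have hY : 0 ≤ ∑ i, y i ^ 2 := Finset.sum_nonneg fun i _ => sq_nonneg _
  by_cases h0 : ∑ i, u i ^ 2 = 0
  · rw [h0]; positivity
  · have hpos : 0 < ∑ i, u i ^ 2 := lt_of_le_of_ne hU (Ne.symm h0)
    have h' : (∑ i, u i ^ 2) * (∑ i, u i ^ 2) ≤ (4 * ω ^ 2 * ∑ i, y i ^ 2) * ∑ i, u i ^ 2 := by nlinarith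
    exact le_of_mul_le_mul_right h' hpos

end Algebra

end Summit.AnomalousDissipation.AnomalousDissipation.Theorems.SolenoidalFractalHomogenisation.LagrangianStep
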